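import Summits.RiemannHypothesis.RiemannHypothesis.Theorems.PfPersistenceFfWeilCriterion
import Summits.RiemannHypothesis.RiemannHypothesis.Theorems.MotivicDoorFfCliff
import Summits.RiemannHypothesis.RiemannHypothesis.Theorems.MotivicDoorFfDictionary

/-!
# Function-field calibration: the DEFINITE DEPTH of the window tower
(pub-rhdoor, unit `ffcal`, gen 6 — FFCAL.md §6 R3 "Weil CERTIFIED 505/505 from `ε_lo > 0` at the
definite depth `M = D̂ − 1`", previously labelled DERIVED; HONEST FRAMING: lottery ticket at the motivic
door; RH probability negligible; consolation prizes are real: a new semi-local Weil-positivity theorem,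
or a located gap in the Connes–Consani programme, plus the ff-door theorem.  Nothing in this file is a
statement about `ζ`: `RH(q, h)` means `|α| = √q` for the complex roots of ONE integer polynomial `h`.)

Setting of `PfPersistenceFfAngleTwin` / `PfPersistenceFfGram` / `PfPersistenceFfWeilCriterion`
(pub-rhpf ffmirror-2, citation of record `4f1b3da6ffbf`) and `MotivicDoorFfCliff` (`fac9c40b82fe`):
datum `(q, A)` or `(q, h)`, normalised roots `U = A/√q`, window forms `T_M = (K(|m - m'|))_{m,m' ≤ M}`,
`D` := the number of DISTINCT normalised roots (`(normRoots q A).toFinset.card`, `= (frobRoots h).toFinset.card`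
by `toFinset_card_normRoots`).

The finite-depth Weil criterion of record (`norm_eq_one_of_ffWindowForm_posSemidef`,
`weilWindowForm_posSemidef_iff`) is typed at depth `#A - 1 = deg h - 1`.  Its proof interpolates on the
DISTINCT nodes only, so the criterion already bites at the DISTINCT-SUPPORT depth `D - 1 ≤ deg h - 1`; this
file records that sharpening and combines it with the cliff (`T_M ≻ 0 ↔ M + 1 ≤ D` under RH) into the
statement the calibration actually used: for `q`-reciprocal data,

* `weilWindowForm_posSemidef_iff_of_toFinset_card`: `D ≤ M + 1 ⇒ (T_M(q, h) ⪰ 0 ↔ RH(q, h))`;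
* `weilWindowForm_not_posDef_of_toFinset_card_le`: `D ≤ M ⇒ ¬ T_M(q, h) ≻ 0` — WITHOUT any RH hypothesis
  (the coefficient vector of the radical `∏_{u distinct}(z - u)` is isotropic for the reciprocal moment form:
  the window tower has rank `≤ D` whatever the moduli of the roots);
* `weilWindowForm_posDef_imp` : `T_M(q, h) ≻ 0 ⇒ M + 1 ≤ D` (same, no RH);
* `ffRH_iff_weilWindowForm_posDef` : at the definite depth `M + 1 = D`, `RH(q, h) ↔ T_M(q, h) ≻ 0` —
  positive DEFINITENESS of the one window of size `D` is exactly the Riemann hypothesis of the datum, and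
  it is the last window that can ever be definite;
* `…_of_fe` versions keyed to the coefficient functional equation of an honest datum (ff-1's dictionary
  `frobRoots_map_reciprocal` / `zero_not_mem_frobRoots`, `5dfd384747f5`).

All [folklore] (finite-rank Carathéodory–Toeplitz for reciprocal data); new only as kernel-checked
statements binding BY NAME to `weilWindowForm`.  For `h` the L-polynomial of a curve `RH(q, h)` is Weil's
theorem, so there the content is: the window of size `D` is positive definite and no larger one is.
-/

set_option linter.dupNamespace false  -- the mandated namespace repeats `RiemannHypothesis`

noncomputable section

open Polynomial Matrix Finset
open scoped ComplexOrder ComplexConjugate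

namespace Summit.RiemannHypothesis.RiemannHypothesis.Theorems.MotivicDoor.FfDefiniteDepth

open Summit.RiemannHypothesis.RiemannHypothesis.Theorems.PfPersistence.FfAngleTwin
open Summit.RiemannHypothesis.RiemannHypothesis.Theorems.MotivicDoor.FfCliff
open Summit.RiemannHypothesis.RiemannHypothesis.Theorems.MotivicDoor.FunctionField

variable {ι : Type*} [Fintype ι]

/-! ## Reciprocal data: the radical is isotropic beyond the distinct count (no RH needed) -/

/-- For inversion- and conjugation-closed normalised roots `U ∌ 0`, the window form VANISHES on the
coefficient vector of any polynomial of degree `≤ M` that kills every normalised root: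
`x* T_M x = ½ Σ_j conj(p(conj u_j))·p(1/u_j) = 0`.  No hypothesis on the moduli `|u_j|`. [folklore] -/
theorem star_dotProduct_ffWindowForm_mulVec_eq_zero_of_eval {q : ℝ} {A : Multiset ℂ}
    (hinv : (normRoots q A).map (·⁻¹) = normRoots q A)
    (hconj : (normRoots q A).map conj = normRoots q A) (h0 : (0:ℂ) ∉ normRoots q A)
    {M : ℕ} {p : ℂ[X]} (hp : p.natDegree ≤ M) (hroot : ∀ z ∈ normRoots q A, p.eval z = 0) :
    star (fun m : Fin (M + 1) => p.coeff m) ⬝ᵥ (ffWindowForm q A M *ᵥ fun m => p.coeff m) = 0 := by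
  obtain ⟨k, u, hU⟩ := exists_eq_univ_val_map (normRoots q A)
  rw [star_dotProduct_ffWindowForm_mulVec hU hinv h0 M, div_eq_zero_iff]
  left
  refine Finset.sum_eq_zero fun i _ => ?_
  have hmc : conj (u i) ∈ normRoots q A := by
    rw [← hconj]; exact Multiset.mem_map_of_mem _ (mem_of_univ_val_map hU i)
  simp only [sum_fin_star_coeff_mul_pow hp, hroot _ hmc, map_zero, zero_mul]

/-- BEYOND THE DISTINCT COUNT NO WINDOW IS DEFINITE, RH or not: if `D ≤ M` (`D` = number of distinct
normalised roots) then `T_M(q, A)` is not positive definite — the coefficient vector of the radical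
`∏_{u ∈ U distinct}(z - u)` is a nonzero isotropic vector. [folklore] -/
theorem ffWindowForm_not_posDef_of_toFinset_card_le {q : ℝ} {A : Multiset ℂ}
    (hinv : (normRoots q A).map (·⁻¹) = normRoots q A)
    (hconj : (normRoots q A).map conj = normRoots q A) (h0 : (0:ℂ) ∉ normRoots q A)
    {M : ℕ} (hM : (normRoots q A).toFinset.card ≤ M) : ¬ (ffWindowForm q A M).PosDef := by
  intro hpd
  set p : ℂ[X] := ((normRoots q A).dedup.map fun w => X - C w).prod with hp
  have hdeg : p.natDegree ≤ M := by
    rw [hp, natDegree_multiset_prod_X_sub_C_eq_card, card_dedup_eq_toFinset_card]; exact hM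
  have hx0 : (fun m : Fin (M + 1) => p.coeff m) ≠ 0 := by
    have h1 := rootPolyCoeff_ne_zero (normRoots q A).dedup (M := M) (j := 0)
      (by rw [card_dedup_eq_toFinset_card]; simpa using hM)
    simpa using h1
  have hzero := star_dotProduct_ffWindowForm_mulVec_eq_zero_of_eval hinv hconj h0 hdeg
    (fun z hz => by rw [hp]; exact eval_rootPoly_eq_zero (Multiset.mem_dedup.2 hz))
  have hpos := hpd.dotProduct_mulVec_pos hx0
  rw [hzero] at hpos
  exact lt_irrefl _ hpos

/-- … hence a positive definite window has size at most `D`: `T_M(q, A) ≻ 0 ⇒ M + 1 ≤ D`. [folklore] -/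
theorem ffWindowForm_posDef_imp {q : ℝ} {A : Multiset ℂ}
    (hinv : (normRoots q A).map (·⁻¹) = normRoots q A)
    (hconj : (normRoots q A).map conj = normRoots q A) (h0 : (0:ℂ) ∉ normRoots q A)
    {M : ℕ} (hpd : (ffWindowForm q A M).PosDef) : M + 1 ≤ (normRoots q A).toFinset.card := by
  by_contra hlt
  exact ffWindowForm_not_posDef_of_toFinset_card_le hinv hconj h0 (M := M) (by omega) hpd

/-! ## The finite-depth converse at the distinct-support depth -/

/-- FINITE-DEPTH CONVERSE AT THE DISTINCT-SUPPORT DEPTH (multiset level): if `U = A/√q` is closed under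
`u ↦ 1/u` and under conjugation, `0 ∉ U`, and ONE window form `T_M(q, A)` with `D ≤ M + 1` (`D` = number of
DISTINCT normalised roots) is positive semidefinite, then every normalised root is unimodular.  Same
Lagrange-interpolation proof as the criterion of record `norm_eq_one_of_ffWindowForm_posSemidef`
(depth `#A ≤ M + 1`, 4f1b3da6ffbf), which interpolates on the distinct nodes anyway. [folklore] -/
theorem norm_eq_one_of_ffWindowForm_posSemidef_of_toFinset_card {q : ℝ} {A : Multiset ℂ}
    (hinv : (normRoots q A).map (·⁻¹) = normRoots q A)
    (hconj : (normRoots q A).map conj = normRoots q A) (h0 : (0:ℂ) ∉ normRoots q A)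
    {M : ℕ} (hM : (normRoots q A).toFinset.card ≤ M + 1) (hpsd : (ffWindowForm q A M).PosSemidef) :
    ∀ z ∈ normRoots q A, ‖z‖ = 1 := by
  by_contra hcon
  push Not at hcon
  obtain ⟨a, haU, ha⟩ := hcon
  obtain ⟨k, u, hU⟩ := exists_eq_univ_val_map (normRoots q A)
  -- the reflected node `1/conj a` differs from `a` because `|a| ≠ 1`
  have ha0 : a ≠ 0 := fun h => h0 (h ▸ haU)
  have hca0 : conj a ≠ 0 := (_root_.map_ne_zero (starRingEnd ℂ)).2 ha0
  have hba : (conj a)⁻¹ ≠ a := by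
    intro h
    have h1 : (conj a)⁻¹ * conj a = 1 := inv_mul_cancel₀ hca0
    rw [h, Complex.mul_conj, Complex.normSq_eq_norm_sq] at h1
    have h2 : ‖a‖ ^ 2 = 1 := by exact_mod_cast h1
    exact ha (by rw [← Real.sqrt_sq (norm_nonneg a), h2, Real.sqrt_one])
  -- nodes = the distinct normalised roots; the Lagrange interpolant of the test values
  set s : Finset ℂ := (normRoots q A).toFinset with hs
  have hinj : Set.InjOn (id : ℂ → ℂ) (s : Set ℂ) := Set.injOn_id _
  set P : ℂ[X] := Lagrange.interpolate s id (offCircleTest a) with hP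
  have hnode : ∀ {z : ℂ}, z ∈ s → P.eval z = offCircleTest a z := fun hz =>
    Lagrange.eval_interpolate_at_node (offCircleTest a) hinj hz
  have has : a ∈ s := Multiset.mem_toFinset.2 haU
  have hPa : P.eval a = 1 := by
    rw [hnode has]; unfold offCircleTest; rw [if_pos (Eq.refl a)]
  have hP0 : P ≠ 0 := by
    intro h; rw [h, eval_zero] at hPa; exact zero_ne_one hPa
  have hdegP : P.natDegree ≤ M := by
    have h1 : P.natDegree < s.card :=
      (natDegree_lt_iff_degree_lt hP0).2 (Lagrange.degree_interpolate_lt (offCircleTest a) hinj)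
    omega
  have hmc : ∀ i, conj (u i) ∈ s := fun i => Multiset.mem_toFinset.2
    (by rw [← hconj]; exact Multiset.mem_map_of_mem _ (mem_of_univ_val_map hU i))
  have hmi : ∀ i, (u i)⁻¹ ∈ s := fun i => Multiset.mem_toFinset.2
    (by rw [← hinv]; exact Multiset.mem_map_of_mem _ (mem_of_univ_val_map hU i))
  -- the value of the form on the coefficient vector of `P`
  set x : Fin (M + 1) → ℂ := fun m => P.coeff m with hx
  set t : Finset (Fin k) := univ.filter fun i => u i = conj a ∨ u i = a⁻¹ with ht
  have hform : star x ⬝ᵥ (ffWindowForm q A M *ᵥ x) = -(t.card : ℂ) / 2 := by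
    rw [star_dotProduct_ffWindowForm_mulVec hU hinv h0 M x]
    congr 1
    calc ∑ i, (∑ m : Fin (M + 1), star (x m) * u i ^ (m : ℕ)) *
            (∑ m' : Fin (M + 1), x m' * (u i)⁻¹ ^ (m' : ℕ))
        = ∑ i, conj (offCircleTest a (conj (u i))) * offCircleTest a (u i)⁻¹ := by
          refine Finset.sum_congr rfl fun i _ => ?_
          simp only [hx]
          rw [sum_fin_star_coeff_mul_pow hdegP, sum_fin_coeff_mul_pow hdegP, hnode (hmc i),
            hnode (hmi i)]
      _ = ∑ i, (if u i = conj a ∨ u i = a⁻¹ then (-1:ℂ) else 0) :=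
          Finset.sum_congr rfl fun i _ => conj_offCircleTest_mul hba (u i)
      _ = -(t.card : ℂ) := by
          rw [Finset.sum_ite, Finset.sum_const_zero, add_zero, Finset.sum_const, nsmul_eq_mul,
            mul_neg_one]
  -- `1/a` is a normalised root, so `t` is nonempty and the form is negative: contradiction
  have hainv : a⁻¹ ∈ normRoots q A := by rw [← hinv]; exact Multiset.mem_map_of_mem _ haU
  rw [← hU] at hainv
  obtain ⟨i₀, -, hi₀⟩ := Multiset.mem_map.1 hainv
  have hcard : 1 ≤ t.card :=
    Finset.one_le_card.2 ⟨i₀, Finset.mem_filter.2 ⟨mem_univ _, Or.inr hi₀⟩⟩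
  have hnonneg := hpsd.dotProduct_mulVec_nonneg x
  rw [hform, show (-(t.card : ℂ) / 2) = ((-(t.card : ℝ) / 2 : ℝ) : ℂ) by push_cast; ring,
    Complex.zero_le_real] at hnonneg
  have : (1:ℝ) ≤ t.card := by exact_mod_cast hcard
  linarith

-- The criterion of record `norm_eq_one_of_ffWindowForm_posSemidef` (4f1b3da6ffbf) is the special case
-- `D ≤ #A ≤ M + 1` (`Multiset.toFinset_card_le` + `card_normRoots`); it is not restated here (gate dedup).

/-! ## Dictionary with integer polynomials: the datum `(q, h)` -/

/-- `0 ∉ frobRoots h ⇒ 0 ∉` the normalised roots (`q > 0`). [folklore] -/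
theorem zero_not_mem_normRoots {q : ℝ} (hq : 0 < q) {h : ℤ[X]} (h0 : (0:ℂ) ∉ frobRoots h) :
    (0:ℂ) ∉ normRoots q (frobRoots h) := by
  intro hz
  obtain ⟨α, hα, hα0⟩ := Multiset.mem_map.1 hz
  rcases (div_eq_zero_iff.1 hα0) with h1 | h1
  · exact h0 (h1 ▸ hα)
  · exact (Real.sqrt_pos.2 hq).ne' (by exact_mod_cast h1)

/-- FINITE-DEPTH WEIL CRITERION AT THE DISTINCT-SUPPORT DEPTH: for `q > 0` and `h ∈ ℤ[x]` whose complex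
roots are closed under `α ↦ q/α` and exclude `0`, ONE window of size `≥ D` (`D` = number of DISTINCT
complex roots of `h`) decides the function-field Riemann hypothesis:
`D ≤ M + 1 ⇒ (T_M(q, h) ⪰ 0 ↔ ∀ α, h(α) = 0 → |α| = √q)`.  Sharpens the depth `deg h ≤ M + 1` of
`weilWindowForm_posSemidef_iff` (4f1b3da6ffbf). [folklore] -/
theorem weilWindowForm_posSemidef_iff_of_toFinset_card {q : ℝ} (hq : 0 < q) {h : ℤ[X]}
    (hrec : (frobRoots h).map (fun α => (q:ℂ) / α) = frobRoots h) (h0 : (0:ℂ) ∉ frobRoots h)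
    {M : ℕ} (hM : (frobRoots h).toFinset.card ≤ M + 1) :
    (weilWindowForm q h M).PosSemidef ↔ ∀ α ∈ frobRoots h, ‖α‖ = Real.sqrt q := by
  refine ⟨fun hpsd => ?_, fun hRH => weilWindowForm_posSemidef hq hRH M⟩
  have hs : (0:ℝ) < Real.sqrt q := Real.sqrt_pos.2 hq
  have key := norm_eq_one_of_ffWindowForm_posSemidef_of_toFinset_card
    (normRoots_map_inv_of_reciprocal hq hrec) (normRoots_frobRoots_map_conj q h)
    (zero_not_mem_normRoots hq h0) (by rwa [toFinset_card_normRoots hq]) hpsd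
  intro α hα
  have h1 := key (α / (Real.sqrt q : ℂ)) (Multiset.mem_map_of_mem _ hα)
  rwa [norm_div, Complex.norm_real, Real.norm_eq_abs, abs_of_pos hs, div_eq_one_iff_eq hs.ne'] at h1

/-- FAILURE IS VISIBLE BY DEPTH `D - 1`: an off-circle root makes every window of size `≥ D` fail to be
positive semidefinite. [folklore] -/
theorem weilWindowForm_not_posSemidef_of_offCircle_of_toFinset_card {q : ℝ} (hq : 0 < q) {h : ℤ[X]}
    (hrec : (frobRoots h).map (fun α => (q:ℂ) / α) = frobRoots h) (h0 : (0:ℂ) ∉ frobRoots h)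
    (hoff : ∃ α ∈ frobRoots h, ‖α‖ ≠ Real.sqrt q) {M : ℕ} (hM : (frobRoots h).toFinset.card ≤ M + 1) :
    ¬ (weilWindowForm q h M).PosSemidef := by
  intro hpsd
  obtain ⟨α, hα, hne⟩ := hoff
  exact hne ((weilWindowForm_posSemidef_iff_of_toFinset_card hq hrec h0 hM).1 hpsd α hα)

/-- BEYOND THE DISTINCT COUNT NO WINDOW OF `(q, h)` IS DEFINITE, RH or not: `D ≤ M ⇒ ¬ T_M(q, h) ≻ 0`
(the window tower of reciprocal data has rank `≤ D`). [folklore] -/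
theorem weilWindowForm_not_posDef_of_toFinset_card_le {q : ℝ} (hq : 0 < q) {h : ℤ[X]}
    (hrec : (frobRoots h).map (fun α => (q:ℂ) / α) = frobRoots h) (h0 : (0:ℂ) ∉ frobRoots h)
    {M : ℕ} (hM : (frobRoots h).toFinset.card ≤ M) : ¬ (weilWindowForm q h M).PosDef := by
  rw [← toFinset_card_normRoots hq] at hM
  exact ffWindowForm_not_posDef_of_toFinset_card_le (normRoots_map_inv_of_reciprocal hq hrec)
    (normRoots_frobRoots_map_conj q h) (zero_not_mem_normRoots hq h0) hM

/-- A positive definite window of reciprocal data has size at most `D`: `T_M(q, h) ≻ 0 ⇒ M + 1 ≤ D`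
— no RH hypothesis. [folklore] -/
theorem weilWindowForm_posDef_imp {q : ℝ} (hq : 0 < q) {h : ℤ[X]}
    (hrec : (frobRoots h).map (fun α => (q:ℂ) / α) = frobRoots h) (h0 : (0:ℂ) ∉ frobRoots h)
    {M : ℕ} (hpd : (weilWindowForm q h M).PosDef) : M + 1 ≤ (frobRoots h).toFinset.card := by
  by_contra hlt
  exact weilWindowForm_not_posDef_of_toFinset_card_le hq hrec h0 (M := M) (by omega) hpd

/-- THE DEFINITE DEPTH: at `M + 1 = D` the one window of size `D` is positive DEFINITE iff `RH(q, h)` —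
and by `weilWindowForm_not_posDef_of_toFinset_card_le` it is the last window that can be definite at all.
(`⇐`: the cliff `weilWindowForm_posDef_iff` of `MotivicDoorFfCliff`, fac9c40b82fe; `⇒`: the criterion at
the distinct-support depth.)  This is the test the blind analyst of FFCAL.md §6 R3 ran: `ε₁(T_{D̂-1}) > 0`
certified ⇒ Weil. [folklore] -/
theorem ffRH_iff_weilWindowForm_posDef {q : ℝ} (hq : 0 < q) {h : ℤ[X]}
    (hrec : (frobRoots h).map (fun α => (q:ℂ) / α) = frobRoots h) (h0 : (0:ℂ) ∉ frobRoots h)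
    {M : ℕ} (hD : (frobRoots h).toFinset.card = M + 1) :
    (∀ α ∈ frobRoots h, ‖α‖ = Real.sqrt q) ↔ (weilWindowForm q h M).PosDef :=
  ⟨fun hRH => (weilWindowForm_posDef_iff hq hRH).2 hD.ge,
    fun hpd => (weilWindowForm_posSemidef_iff_of_toFinset_card hq hrec h0 hD.le).1 hpd.posSemidef⟩

/-- DEFINITENESS = RH + PRE-CLIFF, on the deciding windows: for `D ≤ M + 1`,
`T_M(q, h) ≻ 0 ↔ RH(q, h) ∧ M + 1 = D`. [folklore] -/
theorem weilWindowForm_posDef_iff_ffRH_and_eq {q : ℝ} (hq : 0 < q) {h : ℤ[X]}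
    (hrec : (frobRoots h).map (fun α => (q:ℂ) / α) = frobRoots h) (h0 : (0:ℂ) ∉ frobRoots h)
    {M : ℕ} (hM : (frobRoots h).toFinset.card ≤ M + 1) :
    (weilWindowForm q h M).PosDef ↔
      (∀ α ∈ frobRoots h, ‖α‖ = Real.sqrt q) ∧ (frobRoots h).toFinset.card = M + 1 := by
  constructor
  · intro hpd
    have hle := weilWindowForm_posDef_imp hq hrec h0 hpd
    exact ⟨(weilWindowForm_posSemidef_iff_of_toFinset_card hq hrec h0 hM).1 hpd.posSemidef, by omega⟩
  · rintro ⟨hRH, hD⟩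
    exact (ffRH_iff_weilWindowForm_posDef hq hrec h0 hD).1 hRH

/-! ## Honest data: the same, keyed to the coefficient functional equation (ff-1's dictionary) -/

/-- DISTINCT-SUPPORT DEPTH for an honest datum (`deg h = 2g`, coefficient FE `q^g h_j = q^i h_i`):
`D ≤ M + 1 ⇒ (T_M(q, h) ⪰ 0 ↔ RH(q, h))`, `D` = number of distinct complex roots. [folklore] -/
theorem weilWindowForm_posSemidef_iff_ffRH_of_fe {q : ℕ} (hq : 0 < q) {h : ℤ[X]} {g : ℕ}
    (hdeg : h.natDegree = 2 * g)
    (hFE : ∀ i j, i + j = 2 * g → (q : ℤ) ^ g * h.coeff j = (q : ℤ) ^ i * h.coeff i)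
    {M : ℕ} (hM : (frobRoots h).toFinset.card ≤ M + 1) :
    (weilWindowForm (q : ℝ) h M).PosSemidef ↔ ∀ α ∈ frobRoots h, ‖α‖ = Real.sqrt q := by
  have hrec : (frobRoots h).map (fun α => ((q : ℝ) : ℂ) / α) = frobRoots h := by
    simpa only [Complex.ofReal_natCast] using frobRoots_map_reciprocal hq hdeg hFE
  exact weilWindowForm_posSemidef_iff_of_toFinset_card (by exact_mod_cast hq) hrec
    (zero_not_mem_frobRoots hq hdeg hFE) hM

/-- THE DEFINITE DEPTH for an honest datum: at `M + 1 = D`, `RH(q, h) ↔ T_M(q, h) ≻ 0`. [folklore] -/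
theorem ffRH_iff_weilWindowForm_posDef_of_fe {q : ℕ} (hq : 0 < q) {h : ℤ[X]} {g : ℕ}
    (hdeg : h.natDegree = 2 * g)
    (hFE : ∀ i j, i + j = 2 * g → (q : ℤ) ^ g * h.coeff j = (q : ℤ) ^ i * h.coeff i)
    {M : ℕ} (hD : (frobRoots h).toFinset.card = M + 1) :
    (∀ α ∈ frobRoots h, ‖α‖ = Real.sqrt q) ↔ (weilWindowForm (q : ℝ) h M).PosDef := by
  have hrec : (frobRoots h).map (fun α => ((q : ℝ) : ℂ) / α) = frobRoots h := by
    simpa only [Complex.ofReal_natCast] using frobRoots_map_reciprocal hq hdeg hFE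
  exact ffRH_iff_weilWindowForm_posDef (by exact_mod_cast hq) hrec (zero_not_mem_frobRoots hq hdeg hFE) hD

/-- NO WINDOW PAST `D` IS DEFINITE for an honest datum (no RH hypothesis): `D ≤ M ⇒ ¬ T_M(q, h) ≻ 0`. [folklore] -/
theorem weilWindowForm_not_posDef_of_fe {q : ℕ} (hq : 0 < q) {h : ℤ[X]} {g : ℕ}
    (hdeg : h.natDegree = 2 * g)
    (hFE : ∀ i j, i + j = 2 * g → (q : ℤ) ^ g * h.coeff j = (q : ℤ) ^ i * h.coeff i)
    {M : ℕ} (hM : (frobRoots h).toFinset.card ≤ M) : ¬ (weilWindowForm (q : ℝ) h M).PosDef := by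
  have hrec : (frobRoots h).map (fun α => ((q : ℝ) : ℂ) / α) = frobRoots h := by
    simpa only [Complex.ofReal_natCast] using frobRoots_map_reciprocal hq hdeg hFE
  exact weilWindowForm_not_posDef_of_toFinset_card_le (by exact_mod_cast hq) hrec
    (zero_not_mem_frobRoots hq hdeg hFE) hM

end Summit.RiemannHypothesis.RiemannHypothesis.Theorems.MotivicDoor.FfDefiniteDepth

end
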